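import Summits.QuantumFields.YangMills.Theorems.FluctuationComparisonRegPrIntLOrganTangentILawRegOfWeightLip
import Summits.QuantumFields.YangMills.Theorems.FluctuationComparisonRegPrIntLOrganTangentGaugeConjugateProbe
import HarnessLib

/-!
# Crux `FluctuationComparisonRegPrIntL` (stmt-QuantumFields-20520, rung R3), PATH-B organ, H-currency cone — (L41) «THE TOP-LEVEL PLAQUETTE-DISPLACEMENT MODULUS FROM THE ROW'S
# OWN `hdisp`»: the level-`Ts` instance of the (Φ-disp-Lip) letter of ✓(L39b) `…OrganTangentWeightLipOfChartLetters` — along near relational coarse one-bond PATHS and along the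
# `s`-edges of near relational SQUARES — is a THEOREM of the (I-geo)sq one-bond displacement letter `hdisp` + guard (px19 g22 12:07:53Z: «n = Ts is `hdisp` RE-BASED»)

Cell `ym3-torus` (YM ladder rung R3 = continuum `SU(2)` Yang–Mills on the three-torus — a RUNG: NOT d = 4, NOT infinite volume, NOT a mass gap, NOT Clay).
Width seat `ym-ust-20520-w5` (gen 25), `--kind proof --supports stmt-QuantumFields-20520 --as helper`, count-neutral, DEFINITION-FREE, default heartbeats,
no registry ∕ binder ∕ `Lines/` edit.  Over ✓p822302 `…ILawRegOfWeightLip` (`abs_le_two_of_mem_Ioo`; hub for ✓p820913 `…NearFamilyStability`: ✓p817898 `plaqSmall_relPath_of_le` ∕ `plaqSmall_relSquare_of_le`, ✓p819252 `guard8_of_guard16`,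
✓`expPt_add_smul`, ✓`…SeedHClause.eq_update_of_rel`, `abs_le_two_of_mem_Icc`), ✓`…OrganTangentGaugeConjugateProbe` (`conj_expPt`, `norm_adVec_le` — the `B = B′` square edge),
lit `T3DescentFibreTower.descendTo_self`.

WHY.  ✓(L39b) p822554 reduced (W-Lip) (hence REG′ ×4, ✓p822302) to three chart-primitive moduli; its (Φ-disp-Lip) asks, at EVERY level `j < n ≤ Ts`, a Lipschitz modulus `D` of
`s ↦ dist1 (plaqHol (descendTo n Ts (Φ (X s, z))) p)` on `Set.Ioo (-1) 2`.  At the TOP level `n = Ts` (`descendTo Ts Ts = id`) this is the two-sided, re-based form of the row's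
ONE-SIDED one-bond displacement letter `hdisp` ((I-geo)sq, v0.2 :63–:66): from the base `X s` (in the `θ_j`-window by the guard) the point `X s″` is ONE admissible move
`((s″ − s)•m′` at `B′`, size `≤ rc·θ_j∕4` when `|s″ − s| ≤ 1`), so `hdisp` bounds `d(s″) − d(s)` by `DP p B′·(|s″−s|·‖m′‖∕(θ_j∕4)) ≤ Db·rc·|s″ − s|`, and symmetrically; a
local-to-global step (pairs at distance `≤ δ` ⟹ the whole interval, by equal subdivision inside the convex parameter set) finishes.  Along a SQUARE's `s`-edge with `B = B′` the move
from `X s s′` to `X s″ s′` is the CONJUGATED increment `e^{−s′m′}·e^{(s″−s)m}·e^{s′m′} = expPt (Ad (s″−s)•m)` (✓`conj_expPt`), of sup-size `≤ √3·|s″−s|·‖m‖` (✓`norm_adVec_le`) —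
admissible for `|s″ − s| ≤ 1∕2`, modulus `√3·Db·rc`.  The levels `n < Ts` are NOT in the row (`hdisp` is typed at level `Ts` only): they remain the NEW D0 letter «`hdisp_n`»
(px19 g22; [Balaban1985Variational] Thm 1 (10) ∕ Prop 9 (190), SOURCE only) — not touched here.

WHAT.  §0 [folklore] `lipschitzOnWith_of_local` (local-to-global on a convex real set: a bound for pairs at distance `≤ δ` and `|x − y| ≤ n·δ` on the set ⟹ `LipschitzOnWith`),
`abs_sub_le_three_of_Ioo`.
§1 paths: `dist1_sub_le_of_hdisp_relPath` (the one-sided re-based pair bound, `|s″ − s| ≤ 1`), ★★`topDispLip_relPath_of_hdisp` (`LipschitzOnWith (toNNReal (Db·rc)) (fun s =>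
dist1 (plaqHol (Φ (X s, z)) p)) (Set.Ioo (-1) 2)` for every near relational path, every `z`, every top plaquette `p`).  §2 squares: `relSquare_edge_step` (the `s`-edge increment as ONE
right exponential move at `B`, conjugated when `B = B′`, sup-size `≤ √3·|s″−s|·‖m‖`), `dist1_sub_le_of_hdisp_relSquare`, ★★`topDispLip_relSquare_of_hdisp` (modulus `toNNReal (√3·Db·rc)`,
every `s′ ∈ Icc 0 1`).  §3 `topDispLip_relPath_descendTo` ∕ `topDispLip_relSquare_descendTo`: the same in the letter's `descendTo F ℰp Ts Ts hnT` spelling.  A discharger of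
(Φ-disp-Lip) takes `D := max (√3·Db·rc) (the n < Ts moduli)` and `LipschitzOnWith.weaken`.

HONEST FRAMING: [folklore] window bookkeeping over the HYPOTHESIS letter `hdisp` (exactly as OPEN as before; nothing of Bałaban's chart is constructed); the `n < Ts` displacement moduli,
(Φ-bond-incr), (J-Lip), KER′, (I-curv), (I-cov) untouched and OPEN; `OrganDischargeInputsHJ(sq)` ∕ `SpreadFibreLawH(J)(sq)` UNDISCHARGED; the five registered stubs of
`Lines/semiclassical_s2beta.lean`, crux 20520 and `YM3TorusSU2` are NOT proved; registry untouched; rung R3 = SU(2) YM₃ on T³ at fixed lattice data — NOT d = 4, NOT infinite volume,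
NOT a mass gap, NOT Clay; the Yang–Mills mass gap is NOT proved.  [folklore]
-/

set_option autoImplicit false

noncomputable section

namespace Summit.QuantumFields.YangMills.Theorems.OrganTangentTopDisplacementLipOfHdisp

open Set Function
open scoped NNReal
open Literature.MathematicalPhysics.QuantumFieldTheory.Balaban1983to89 T3ContinuumYM3Torus T3NestedUnitLaws T3UnitLawDensityEML T4Continuum BalabanUVClass
  T3UnitScaleTilt T3LevelShift T3TiltDescent
open T4CubeChartExp (expPt)
open Summit.QuantumFields.YangMills.Theorems.OrganTangentILawKnitFacts (plaqSmall_mono abs_le_two_of_mem_Icc)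
open Summit.QuantumFields.YangMills.Theorems.OrganTangentRelPathWindow (plaqSmall_relPath_of_le plaqSmall_relSquare_of_le)
open Summit.QuantumFields.YangMills.Theorems.OrganTangentNearDisplacement (norm_smul_le_of_abs_le_one)
open Summit.QuantumFields.YangMills.Theorems.OrganTangentNearStability (guard8_of_guard16)
open Summit.QuantumFields.YangMills.Theorems.OrganTangentSmallStepWindowPath (expPt_add_smul)
open Summit.QuantumFields.YangMills.Theorems.OrganTangentSeedHClause (eq_update_of_rel)
open Summit.QuantumFields.YangMills.Theorems.OrganTangentILawRegOfWeightLip (abs_le_two_of_mem_Ioo)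
open B15Prop1ChartSU2 (adSU2)
open Summit.QuantumFields.YangMills.Theorems.OrganTangentGaugeConjugateProbe (conj_expPt norm_adVec_le)

/-! ## §0 Folklore: local-to-global Lipschitz on a convex real set -/

section Folklore

/-- **LOCAL-TO-GLOBAL**: on a convex set `I ⊆ ℝ` on which `|x − y| ≤ n·δ`, a Lipschitz bound for pairs at distance `≤ δ` gives `LipschitzOnWith K` on `I` (equal subdivision
into `n` steps, all inside `I`). [folklore] -/
theorem lipschitzOnWith_of_local {g : ℝ → ℝ} {I : Set ℝ} (hI : Convex ℝ I) {K : ℝ≥0} (δ : ℝ) (n : ℕ) (hn : 0 < n)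
    (hdiam : ∀ x ∈ I, ∀ y ∈ I, |x - y| ≤ n * δ)
    (hloc : ∀ x ∈ I, ∀ y ∈ I, |x - y| ≤ δ → |g x - g y| ≤ K * |x - y|) :
    LipschitzOnWith K g I := by
  refine LipschitzOnWith.of_dist_le_mul fun x hx y hy => ?_
  rw [Real.dist_eq, Real.dist_eq]
  -- subdivision points `q i := y + i·(x − y)∕n`, `i = 0 … n`, all in `I`
  set q : ℕ → ℝ := fun i => y + (i : ℝ) * ((x - y) / n) with hq
  have hn' : (0 : ℝ) < n := by exact_mod_cast hn
  have hqI : ∀ i ≤ n, q i ∈ I := by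
    intro i hi
    have ht0 : 0 ≤ (i : ℝ) / n := by positivity
    have ht1 : (i : ℝ) / n ≤ 1 := by rw [div_le_one hn']; exact_mod_cast hi
    have hmem := hI hy hx (sub_nonneg.2 ht1) ht0 (by ring)
    have e : (1 - (i : ℝ) / n) • y + ((i : ℝ) / n) • x = q i := by simp only [hq, smul_eq_mul]; field_simp; ring
    rw [e] at hmem
    exact hmem
  have hstep : ∀ i < n, |g (q (i + 1)) - g (q i)| ≤ K * (|x - y| / n) := by
    intro i hi
    have hd : q (i + 1) - q i = (x - y) / n := by simp only [hq]; push_cast; ring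
    have habs : |q (i + 1) - q i| = |x - y| / n := by rw [hd, abs_div, abs_of_pos hn']
    have hle : |q (i + 1) - q i| ≤ δ := by
      rw [habs, div_le_iff₀ hn']
      calc |x - y| ≤ n * δ := hdiam x hx y hy
        _ = δ * n := mul_comm _ _
    have h := hloc (q (i + 1)) (hqI (i + 1) hi) (q i) (hqI i hi.le) hle
    rwa [habs] at h
  -- telescope
  have htel : ∀ m ≤ n, |g (q m) - g (q 0)| ≤ m * (K * (|x - y| / n)) := by
    intro m hm
    induction m with
    | zero => simp
    | succ m ih =>
      have h1 := ih (Nat.le_of_succ_le hm)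
      have h2 := hstep m (Nat.lt_of_succ_le hm)
      calc |g (q (m + 1)) - g (q 0)| = |(g (q (m + 1)) - g (q m)) + (g (q m) - g (q 0))| := by ring_nf
        _ ≤ |g (q (m + 1)) - g (q m)| + |g (q m) - g (q 0)| := abs_add_le _ _
        _ ≤ K * (|x - y| / n) + m * (K * (|x - y| / n)) := add_le_add h2 h1
        _ = ((m + 1 : ℕ) : ℝ) * (K * (|x - y| / n)) := by push_cast; ring
  have hq0 : q 0 = y := by simp [hq]
  have hqn : q n = x := by simp only [hq]; field_simp; ring
  have h := htel n le_rfl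
  rw [hq0, hqn] at h
  calc |g x - g y| ≤ n * (K * (|x - y| / n)) := h
    _ = K * |x - y| := by field_simp

/-- On `Ioo (-1) 2` two points are at distance `≤ 3 = 6·(1∕2)`. [folklore] -/
theorem abs_sub_le_three_of_Ioo {x y : ℝ} (hx : x ∈ Set.Ioo (-1 : ℝ) 2) (hy : y ∈ Set.Ioo (-1 : ℝ) 2) : |x - y| ≤ 3 :=
  abs_le.2 ⟨by linarith [hx.1, hy.2], by linarith [hx.2, hy.1]⟩

end Folklore

/-! ## §1 Near relational PATHS: the top-level displacement is `Db·rc`-Lipschitz from `hdisp` -/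

section Paths

variable (F : T3Family) (γ b₀ p₀ : ℝ) (j Ts : ℕ) {Z : Type}
  (Φ : GaugeField (F.P j) 0 ↥(Matrix.specialUnitaryGroup (Fin 2) ℂ) × Z → GaugeField (F.P Ts) 0 ↥(Matrix.specialUnitaryGroup (Fin 2) ℂ))

/-- The ONE-SIDED re-based pair bound along a near relational path: for `s, s″ ∈ Ioo (-1) 2` with `|s″ − s| ≤ 1`,
`d(s″) ≤ d(s) + Db·rc·|s″ − s|` where `d(σ) := dist1 (plaqHol (Φ (X σ, z)) p)`. [folklore] -/
theorem dist1_sub_le_of_hdisp_relPath (hθj : 0 < θBal F.L γ b₀ p₀ j) (Db rc : ℝ) (hrc : 0 ≤ rc) (hDb0 : 0 ≤ Db)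
    (DP : Plaq (F.P Ts) 0 → PBond (F.P j) 0 → ℝ) (hDb : ∀ p b, DP p b ≤ Db)
    (hguard : (1 + 16 * Real.sqrt 3 * rc) * (θBal F.L γ b₀ p₀ j / 4) ≤ θBal F.L γ b₀ p₀ j)
    (hdisp : ∀ (z : Z) (X : GaugeField (F.P j) 0 ↥(Matrix.specialUnitaryGroup (Fin 2) ℂ)), PlaqSmall (θBal F.L γ b₀ p₀ j) X →
      ∀ (b : PBond (F.P j) 0) (v : Fin 3 → ℝ), ‖v‖ ≤ rc * (θBal F.L γ b₀ p₀ j / 4) → ∀ s ∈ Icc (0 : ℝ) 1, ∀ p : Plaq (F.P Ts) 0,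
        dist1 (GaugeField.plaqHol (Φ (update X b (X b * expPt (s • v)), z)) p)
          ≤ dist1 (GaugeField.plaqHol (Φ (X, z)) p) + DP p b * (‖v‖ / (θBal F.L γ b₀ p₀ j / 4)))
    (z : Z) (B' : PBond (F.P j) 0) (m' : Fin 3 → ℝ) (U₂ : GaugeField (F.P j) 0 ↥(Matrix.specialUnitaryGroup (Fin 2) ℂ))
    (X : ℝ → GaugeField (F.P j) 0 ↥(Matrix.specialUnitaryGroup (Fin 2) ℂ)) (hm' : ‖m'‖ ≤ rc * (θBal F.L γ b₀ p₀ j / 4)) (hU₂ : PlaqSmall (θBal F.L γ b₀ p₀ j / 4) U₂)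
    (hoff : ∀ s e, e ≠ B' → X s e = U₂ e) (hon : ∀ s, X s B' = U₂ B' * expPt (s • m')) (p : Plaq (F.P Ts) 0)
    {s s'' : ℝ} (hs : s ∈ Set.Ioo (-1 : ℝ) 2) (hss : |s'' - s| ≤ 1) :
    dist1 (GaugeField.plaqHol (Φ (X s'', z)) p) ≤ dist1 (GaugeField.plaqHol (Φ (X s, z)) p) + Db * rc * |s'' - s| := by
  have hθ4 : 0 < θBal F.L γ b₀ p₀ j / 4 := by positivity
  have hXs : PlaqSmall (θBal F.L γ b₀ p₀ j) (X s) :=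
    plaqSmall_mono (guard8_of_guard16 hrc hθj.le hguard) (plaqSmall_relPath_of_le hU₂ hm' hoff hon (abs_le_two_of_mem_Ioo hs))
  -- the move `X s → X s″` is `(s″ − s)•m′` at `B′`
  set v : Fin 3 → ℝ := (s'' - s) • m' with hv
  have hvn : ‖v‖ = |s'' - s| * ‖m'‖ := by rw [hv, norm_smul, Real.norm_eq_abs]
  have hvle : ‖v‖ ≤ rc * (θBal F.L γ b₀ p₀ j / 4) := by
    rw [hvn]
    calc |s'' - s| * ‖m'‖ ≤ 1 * ‖m'‖ := mul_le_mul_of_nonneg_right hss (norm_nonneg _)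
      _ ≤ rc * (θBal F.L γ b₀ p₀ j / 4) := by rw [one_mul]; exact hm'
  have hsm : (s + (s'' - s)) • m' = s'' • m' := by congr 1; ring
  have hrel : X s'' = update (X s) B' (X s B' * expPt ((1 : ℝ) • v)) := by
    refine eq_update_of_rel (fun e he => by rw [hoff s'' e he, hoff s e he]) ?_
    rw [one_smul, hv, hon s'', hon s, mul_assoc, ← expPt_add_smul, hsm]
  have h := hdisp z (X s) hXs B' v hvle 1 ⟨zero_le_one, le_rfl⟩ p
  rw [← hrel] at h
  have hDP : DP p B' * (‖v‖ / (θBal F.L γ b₀ p₀ j / 4)) ≤ Db * rc * |s'' - s| := by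
    have h1 : ‖v‖ / (θBal F.L γ b₀ p₀ j / 4) ≤ rc * |s'' - s| := by
      rw [div_le_iff₀ hθ4, hvn]
      calc |s'' - s| * ‖m'‖ ≤ |s'' - s| * (rc * (θBal F.L γ b₀ p₀ j / 4)) := mul_le_mul_of_nonneg_left hm' (abs_nonneg _)
        _ = rc * |s'' - s| * (θBal F.L γ b₀ p₀ j / 4) := by ring
    have h2 : 0 ≤ ‖v‖ / (θBal F.L γ b₀ p₀ j / 4) := by positivity
    calc DP p B' * (‖v‖ / (θBal F.L γ b₀ p₀ j / 4)) ≤ Db * (‖v‖ / (θBal F.L γ b₀ p₀ j / 4)) := mul_le_mul_of_nonneg_right (hDb p B') h2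
      _ ≤ Db * (rc * |s'' - s|) := mul_le_mul_of_nonneg_left h1 hDb0
      _ = Db * rc * |s'' - s| := by ring
  linarith

/-- ★★ **THE TOP-LEVEL DISPLACEMENT ALONG A NEAR RELATIONAL PATH IS `Db·rc`-LIPSCHITZ** on `Set.Ioo (-1) 2`, from `hdisp` + guard. [folklore] -/
theorem topDispLip_relPath_of_hdisp (hθj : 0 < θBal F.L γ b₀ p₀ j) (Db rc : ℝ) (hrc : 0 ≤ rc) (hDb0 : 0 ≤ Db)
    (DP : Plaq (F.P Ts) 0 → PBond (F.P j) 0 → ℝ) (hDb : ∀ p b, DP p b ≤ Db)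
    (hguard : (1 + 16 * Real.sqrt 3 * rc) * (θBal F.L γ b₀ p₀ j / 4) ≤ θBal F.L γ b₀ p₀ j)
    (hdisp : ∀ (z : Z) (X : GaugeField (F.P j) 0 ↥(Matrix.specialUnitaryGroup (Fin 2) ℂ)), PlaqSmall (θBal F.L γ b₀ p₀ j) X →
      ∀ (b : PBond (F.P j) 0) (v : Fin 3 → ℝ), ‖v‖ ≤ rc * (θBal F.L γ b₀ p₀ j / 4) → ∀ s ∈ Icc (0 : ℝ) 1, ∀ p : Plaq (F.P Ts) 0,
        dist1 (GaugeField.plaqHol (Φ (update X b (X b * expPt (s • v)), z)) p)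
          ≤ dist1 (GaugeField.plaqHol (Φ (X, z)) p) + DP p b * (‖v‖ / (θBal F.L γ b₀ p₀ j / 4))) :
    ∀ (B' : PBond (F.P j) 0) (m' : Fin 3 → ℝ) (U₂ : GaugeField (F.P j) 0 ↥(Matrix.specialUnitaryGroup (Fin 2) ℂ))
      (X : ℝ → GaugeField (F.P j) 0 ↥(Matrix.specialUnitaryGroup (Fin 2) ℂ)), ‖m'‖ ≤ rc * (θBal F.L γ b₀ p₀ j / 4) → PlaqSmall (θBal F.L γ b₀ p₀ j / 4) U₂ →
      (∀ s e, e ≠ B' → X s e = U₂ e) → (∀ s, X s B' = U₂ B' * expPt (s • m')) → ∀ (z : Z) (p : Plaq (F.P Ts) 0),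
        LipschitzOnWith (Real.toNNReal (Db * rc)) (fun s => dist1 (GaugeField.plaqHol (Φ (X s, z)) p)) (Set.Ioo (-1) 2) := by
  intro B' m' U₂ X hm' hU₂ hoff hon z p
  refine lipschitzOnWith_of_local (convex_Ioo (-1 : ℝ) 2) 1 3 (by norm_num) (fun x hx y hy => by
    norm_num; exact abs_sub_le_three_of_Ioo hx hy) fun x hx y hy hxy => ?_
  have h1 := dist1_sub_le_of_hdisp_relPath F γ b₀ p₀ j Ts Φ hθj Db rc hrc hDb0 DP hDb hguard hdisp z B' m' U₂ X hm' hU₂ hoff hon p hy hxy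
  have h2 := dist1_sub_le_of_hdisp_relPath F γ b₀ p₀ j Ts Φ hθj Db rc hrc hDb0 DP hDb hguard hdisp z B' m' U₂ X hm' hU₂ hoff hon p hx
    (by rw [abs_sub_comm]; exact hxy)
  rw [abs_sub_comm y x] at h2
  have hK : (Db * rc) * |x - y| ≤ (Real.toNNReal (Db * rc) : ℝ) * |x - y| := mul_le_mul_of_nonneg_right (Real.le_coe_toNNReal _) (abs_nonneg _)
  rw [abs_le]
  constructor <;> linarith

end Paths

/-! ## §2 Near relational SQUARES: the top-level displacement along an `s`-edge is `√3·Db·rc`-Lipschitz from `hdisp` -/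

section Squares

variable (F : T3Family) (γ b₀ p₀ : ℝ) (j Ts : ℕ) {Z : Type}
  (Φ : GaugeField (F.P j) 0 ↥(Matrix.specialUnitaryGroup (Fin 2) ℂ) × Z → GaugeField (F.P Ts) 0 ↥(Matrix.specialUnitaryGroup (Fin 2) ℂ))

/-- ★ **THE `s`-EDGE INCREMENT OF A RELATIONAL SQUARE IS ONE RIGHT EXPONENTIAL MOVE AT `B`** — conjugated by `e^{s′m′}` when `B = B′` — of sup-size `≤ √3·|s″ − s|·‖m‖`:
`∃ v, ‖v‖ ≤ √3·(|s″−s|·‖m‖) ∧ (∀ e ≠ B, X s″ s′ e = X s s′ e) ∧ X s″ s′ B = X s s′ B·expPt v`. [folklore] -/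
theorem relSquare_edge_step {P : Params} {i : ℕ} {V00 : GaugeField P i (Matrix.specialUnitaryGroup (Fin 2) ℂ)} {B B' : PBond P i} {m m' : Fin 3 → ℝ}
    {Y : ℝ → GaugeField P i (Matrix.specialUnitaryGroup (Fin 2) ℂ)} {X : ℝ → ℝ → GaugeField P i (Matrix.specialUnitaryGroup (Fin 2) ℂ)}
    (hYoff : ∀ s e, e ≠ B → Y s e = V00 e) (hYon : ∀ s, Y s B = V00 B * expPt (s • m))
    (hXoff : ∀ s s' e, e ≠ B' → X s s' e = Y s e) (hXon : ∀ s s', X s s' B' = Y s B' * expPt (s' • m')) (s s'' s' : ℝ) :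
    ∃ v : Fin 3 → ℝ, ‖v‖ ≤ Real.sqrt 3 * (|s'' - s| * ‖m‖) ∧ (∀ e, e ≠ B → X s'' s' e = X s s' e) ∧ X s'' s' B = X s s' B * expPt v := by
  by_cases hBB : B = B'
  · -- `B = B′`: conjugate the increment `e^{(s″−s)m}` past `e^{s′m′}`
    subst hBB
    refine ⟨WithLp.ofLp (adSU2 (expPt (s' • m'))⁻¹ (T4CubeChartExp.toE ((s'' - s) • m))), ?_, fun e he => ?_, ?_⟩
    · refine (norm_adVec_le _ _).trans ?_
      rw [norm_smul, Real.norm_eq_abs]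
    · rw [hXoff s'' s' e he, hXoff s s' e he, hYoff s'' e he, hYoff s e he]
    · have hsm : s'' • m = (s + (s'' - s)) • m := by congr 1; ring
      rw [hXon s'' s', hXon s s', hYon s'', hYon s, ← conj_expPt, inv_inv, hsm, expPt_add_smul]
      simp only [mul_assoc, mul_inv_cancel_left]
  · refine ⟨(s'' - s) • m, ?_, fun e he => ?_, ?_⟩
    · rw [norm_smul, Real.norm_eq_abs]
      have h3 : (1 : ℝ) ≤ Real.sqrt 3 := by
        rw [show (1:ℝ) = Real.sqrt 1 by simp]; exact Real.sqrt_le_sqrt (by norm_num)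
      exact le_mul_of_one_le_left (by positivity) h3
    · by_cases he' : e = B'
      · subst he'; rw [hXon s'' s', hXon s s', hYoff s'' e he, hYoff s e he]
      · rw [hXoff s'' s' e he', hXoff s s' e he', hYoff s'' e he, hYoff s e he]
    · have hne : B ≠ B' := hBB
      have hsm : (s + (s'' - s)) • m = s'' • m := by congr 1; ring
      rw [hXoff s'' s' B hne, hXoff s s' B hne, hYon s'', hYon s, mul_assoc, ← expPt_add_smul, hsm]

/-- The one-sided re-based pair bound along an `s`-edge of a near relational square: for `s, s″ ∈ Ioo (-1) 2`, `|s″ − s| ≤ 1∕2`, `s′ ∈ Icc 0 1`,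
`d(s″) ≤ d(s) + √3·Db·rc·|s″ − s|`, `d(σ) := dist1 (plaqHol (Φ (X σ s′, z)) p)`. [folklore] -/
theorem dist1_sub_le_of_hdisp_relSquare (hθj : 0 < θBal F.L γ b₀ p₀ j) (Db rc : ℝ) (hDb0 : 0 ≤ Db)
    (DP : Plaq (F.P Ts) 0 → PBond (F.P j) 0 → ℝ) (hDb : ∀ p b, DP p b ≤ Db)
    (hguard : (1 + 16 * Real.sqrt 3 * rc) * (θBal F.L γ b₀ p₀ j / 4) ≤ θBal F.L γ b₀ p₀ j)
    (hdisp : ∀ (z : Z) (X : GaugeField (F.P j) 0 ↥(Matrix.specialUnitaryGroup (Fin 2) ℂ)), PlaqSmall (θBal F.L γ b₀ p₀ j) X →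
      ∀ (b : PBond (F.P j) 0) (v : Fin 3 → ℝ), ‖v‖ ≤ rc * (θBal F.L γ b₀ p₀ j / 4) → ∀ s ∈ Icc (0 : ℝ) 1, ∀ p : Plaq (F.P Ts) 0,
        dist1 (GaugeField.plaqHol (Φ (update X b (X b * expPt (s • v)), z)) p)
          ≤ dist1 (GaugeField.plaqHol (Φ (X, z)) p) + DP p b * (‖v‖ / (θBal F.L γ b₀ p₀ j / 4)))
    (z : Z) (B B' : PBond (F.P j) 0) (m m' : Fin 3 → ℝ) (V00 : GaugeField (F.P j) 0 ↥(Matrix.specialUnitaryGroup (Fin 2) ℂ))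
    (Y : ℝ → GaugeField (F.P j) 0 ↥(Matrix.specialUnitaryGroup (Fin 2) ℂ)) (X : ℝ → ℝ → GaugeField (F.P j) 0 ↥(Matrix.specialUnitaryGroup (Fin 2) ℂ))
    (hm : ‖m‖ ≤ rc * (θBal F.L γ b₀ p₀ j / 4)) (hm' : ‖m'‖ ≤ rc * (θBal F.L γ b₀ p₀ j / 4)) (hV : PlaqSmall (θBal F.L γ b₀ p₀ j / 4) V00)
    (hYoff : ∀ s e, e ≠ B → Y s e = V00 e) (hYon : ∀ s, Y s B = V00 B * expPt (s • m))
    (hXoff : ∀ s s' e, e ≠ B' → X s s' e = Y s e) (hXon : ∀ s s', X s s' B' = Y s B' * expPt (s' • m'))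
    {s' : ℝ} (hs' : s' ∈ Set.Icc (0 : ℝ) 1) (p : Plaq (F.P Ts) 0)
    {s s'' : ℝ} (hs : s ∈ Set.Ioo (-1 : ℝ) 2) (hss : |s'' - s| ≤ 1 / 2) :
    dist1 (GaugeField.plaqHol (Φ (X s'' s', z)) p) ≤ dist1 (GaugeField.plaqHol (Φ (X s s', z)) p) + Real.sqrt 3 * Db * rc * |s'' - s| := by
  have hθ4 : 0 < θBal F.L γ b₀ p₀ j / 4 := by positivity
  have hXs : PlaqSmall (θBal F.L γ b₀ p₀ j) (X s s') :=
    plaqSmall_mono hguard (plaqSmall_relSquare_of_le hV hm hm' hYoff hYon hXoff hXon (abs_le_two_of_mem_Ioo hs) (abs_le_two_of_mem_Icc hs'))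
  obtain ⟨v, hvn, hvoff, hvon⟩ := relSquare_edge_step hYoff hYon hXoff hXon s s'' s'
  have h3 : Real.sqrt 3 ≤ 2 := by
    rw [show (2:ℝ) = Real.sqrt 4 by rw [show (4:ℝ) = 2 ^ 2 by norm_num, Real.sqrt_sq (by norm_num : (0:ℝ) ≤ 2)]]
    exact Real.sqrt_le_sqrt (by norm_num)
  have h30 : 0 ≤ Real.sqrt 3 := Real.sqrt_nonneg 3
  have hvle : ‖v‖ ≤ rc * (θBal F.L γ b₀ p₀ j / 4) := by
    refine hvn.trans ?_
    calc Real.sqrt 3 * (|s'' - s| * ‖m‖) ≤ 2 * ((1 / 2) * ‖m‖) :=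
          mul_le_mul h3 (mul_le_mul_of_nonneg_right hss (norm_nonneg _)) (by positivity) (by norm_num)
      _ = ‖m‖ := by ring
      _ ≤ rc * (θBal F.L γ b₀ p₀ j / 4) := hm
  have hrel : X s'' s' = update (X s s') B (X s s' B * expPt ((1 : ℝ) • v)) := by
    rw [one_smul]; exact eq_update_of_rel hvoff hvon
  have h := hdisp z (X s s') hXs B v hvle 1 ⟨zero_le_one, le_rfl⟩ p
  rw [← hrel] at h
  have hDP : DP p B * (‖v‖ / (θBal F.L γ b₀ p₀ j / 4)) ≤ Real.sqrt 3 * Db * rc * |s'' - s| := by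
    have h1 : ‖v‖ / (θBal F.L γ b₀ p₀ j / 4) ≤ Real.sqrt 3 * rc * |s'' - s| := by
      rw [div_le_iff₀ hθ4]
      calc ‖v‖ ≤ Real.sqrt 3 * (|s'' - s| * ‖m‖) := hvn
        _ ≤ Real.sqrt 3 * (|s'' - s| * (rc * (θBal F.L γ b₀ p₀ j / 4))) :=
            mul_le_mul_of_nonneg_left (mul_le_mul_of_nonneg_left hm (abs_nonneg _)) h30
        _ = Real.sqrt 3 * rc * |s'' - s| * (θBal F.L γ b₀ p₀ j / 4) := by ring
    have h2 : 0 ≤ ‖v‖ / (θBal F.L γ b₀ p₀ j / 4) := by positivity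
    calc DP p B * (‖v‖ / (θBal F.L γ b₀ p₀ j / 4)) ≤ Db * (‖v‖ / (θBal F.L γ b₀ p₀ j / 4)) := mul_le_mul_of_nonneg_right (hDb p B) h2
      _ ≤ Db * (Real.sqrt 3 * rc * |s'' - s|) := mul_le_mul_of_nonneg_left h1 hDb0
      _ = Real.sqrt 3 * Db * rc * |s'' - s| := by ring
  linarith

/-- ★★ **THE TOP-LEVEL DISPLACEMENT ALONG AN `s`-EDGE OF A NEAR RELATIONAL SQUARE IS `√3·Db·rc`-LIPSCHITZ** on `Set.Ioo (-1) 2`, for every `s′ ∈ Icc 0 1`, from `hdisp` + guard.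
[folklore] -/
theorem topDispLip_relSquare_of_hdisp (hθj : 0 < θBal F.L γ b₀ p₀ j) (Db rc : ℝ) (hDb0 : 0 ≤ Db)
    (DP : Plaq (F.P Ts) 0 → PBond (F.P j) 0 → ℝ) (hDb : ∀ p b, DP p b ≤ Db)
    (hguard : (1 + 16 * Real.sqrt 3 * rc) * (θBal F.L γ b₀ p₀ j / 4) ≤ θBal F.L γ b₀ p₀ j)
    (hdisp : ∀ (z : Z) (X : GaugeField (F.P j) 0 ↥(Matrix.specialUnitaryGroup (Fin 2) ℂ)), PlaqSmall (θBal F.L γ b₀ p₀ j) X →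
      ∀ (b : PBond (F.P j) 0) (v : Fin 3 → ℝ), ‖v‖ ≤ rc * (θBal F.L γ b₀ p₀ j / 4) → ∀ s ∈ Icc (0 : ℝ) 1, ∀ p : Plaq (F.P Ts) 0,
        dist1 (GaugeField.plaqHol (Φ (update X b (X b * expPt (s • v)), z)) p)
          ≤ dist1 (GaugeField.plaqHol (Φ (X, z)) p) + DP p b * (‖v‖ / (θBal F.L γ b₀ p₀ j / 4))) :
    ∀ (B B' : PBond (F.P j) 0) (m m' : Fin 3 → ℝ) (V00 : GaugeField (F.P j) 0 ↥(Matrix.specialUnitaryGroup (Fin 2) ℂ))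
      (Y : ℝ → GaugeField (F.P j) 0 ↥(Matrix.specialUnitaryGroup (Fin 2) ℂ)) (X : ℝ → ℝ → GaugeField (F.P j) 0 ↥(Matrix.specialUnitaryGroup (Fin 2) ℂ)),
      ‖m‖ ≤ rc * (θBal F.L γ b₀ p₀ j / 4) → ‖m'‖ ≤ rc * (θBal F.L γ b₀ p₀ j / 4) → PlaqSmall (θBal F.L γ b₀ p₀ j / 4) V00 →
      (∀ s e, e ≠ B → Y s e = V00 e) → (∀ s, Y s B = V00 B * expPt (s • m)) → (∀ s s' e, e ≠ B' → X s s' e = Y s e) → (∀ s s', X s s' B' = Y s B' * expPt (s' • m')) →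
      ∀ s' ∈ Set.Icc (0:ℝ) 1, ∀ (z : Z) (p : Plaq (F.P Ts) 0),
        LipschitzOnWith (Real.toNNReal (Real.sqrt 3 * Db * rc)) (fun s => dist1 (GaugeField.plaqHol (Φ (X s s', z)) p)) (Set.Ioo (-1) 2) := by
  intro B B' m m' V00 Y X hm hm' hV hYoff hYon hXoff hXon s' hs' z p
  refine lipschitzOnWith_of_local (convex_Ioo (-1 : ℝ) 2) (1 / 2) 6 (by norm_num) (fun x hx y hy => by
    norm_num; exact abs_sub_le_three_of_Ioo hx hy) fun x hx y hy hxy => ?_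
  have h1 := dist1_sub_le_of_hdisp_relSquare F γ b₀ p₀ j Ts Φ hθj Db rc hDb0 DP hDb hguard hdisp z B B' m m' V00 Y X hm hm' hV hYoff hYon hXoff hXon hs' p hy hxy
  have h2 := dist1_sub_le_of_hdisp_relSquare F γ b₀ p₀ j Ts Φ hθj Db rc hDb0 DP hDb hguard hdisp z B B' m m' V00 Y X hm hm' hV hYoff hYon hXoff hXon hs' p hx
    (by rw [abs_sub_comm]; exact hxy)
  rw [abs_sub_comm y x] at h2
  have hK : (Real.sqrt 3 * Db * rc) * |x - y| ≤ (Real.toNNReal (Real.sqrt 3 * Db * rc) : ℝ) * |x - y| :=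
    mul_le_mul_of_nonneg_right (Real.le_coe_toNNReal _) (abs_nonneg _)
  rw [abs_le]
  constructor <;> linarith

end Squares

/-! ## §3 The letter's `descendTo Ts Ts` spelling -/

section DescendTo

variable (F : T3Family) (γ b₀ p₀ : ℝ) (j Ts : ℕ) {Z : Type}
  (Φ : GaugeField (F.P j) 0 ↥(Matrix.specialUnitaryGroup (Fin 2) ℂ) × Z → GaugeField (F.P Ts) 0 ↥(Matrix.specialUnitaryGroup (Fin 2) ℂ))

/-- The top level of the (Φ-disp-Lip) letter reads through `descendTo F ℰp Ts Ts _ = id`: any modulus for `s ↦ dist1 (plaqHol (Φ (C s, z)) p)` is one for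
`s ↦ dist1 (plaqHol (descendTo F ℰp Ts Ts hnT (Φ (C s, z))) p)`. [folklore] -/
theorem lipschitzOnWith_descendTo_self {K : ℝ≥0} {I : Set ℝ} (C : ℝ → GaugeField (F.P j) 0 ↥(Matrix.specialUnitaryGroup (Fin 2) ℂ)) (z : Z)
    (hnT : Ts ≤ Ts) (p : Plaq (F.P Ts) 0) (h : LipschitzOnWith K (fun s => dist1 (GaugeField.plaqHol (Φ (C s, z)) p)) I) :
    LipschitzOnWith K (fun s => dist1 (GaugeField.plaqHol (descendTo F ℰp Ts Ts hnT (Φ (C s, z))) p)) I := by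
  have e : (fun s => dist1 (GaugeField.plaqHol (descendTo F ℰp Ts Ts hnT (Φ (C s, z))) p)) = fun s => dist1 (GaugeField.plaqHol (Φ (C s, z)) p) := by
    funext s; rw [T3DescentFibreTower.descendTo_self]
  rw [e]; exact h

end DescendTo

end Summit.QuantumFields.YangMills.Theorems.OrganTangentTopDisplacementLipOfHdisp

end
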